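import Mathlib.Analysis.SpecialFunctions.Bernstein
import Mathlib.MeasureTheory.Constructions.Polish.StronglyMeasurable
import Literature.Probability.RandomPlanarGeometry.SLE
import Literature.Probability.RandomPlanarGeometry.HalfPlaneAutomorphism
import Literature.Probability.RandomPlanarGeometry.CaratheodoryExtension
import Literature.Topology.PlaneTopology.JordanCurveProofs
import HarnessLib

/-!
# Independence of the uniformizing map for chordal SLE_κ: reduction to named facts

This file works towards the named fact `Literature.Probability.RandomPlanarGeometry.IsSLECurve.map_eq` of
`Literature.Probability.RandomPlanarGeometry.SLE` (two chordal SLE_κ random curves in the same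
Dobrushin domain `(D; a, b)` have the same law). The printed argument (Lawler (2005), §6.1,
paragraph after Remark 6.7; Rohde–Schramm (2005), Prop. 2.1 (i)) is:

1. two chordal uniformizing maps `φ, φ' : ℍₒ → D` differ by a dilation, `φ' = φ ∘ (r • ·)` on `ℍₒ`
   (`Literature.Probability.RandomPlanarGeometry.MarkedDomain.IsChordalUniformizing.exists_eq_trans_smul`, named fact);
2. hence their boundary extensions satisfy `Φ' x = Φ (r • x)` for *every* `x`
   (`Literature.Probability.RandomPlanarGeometry.ConformalEquiv.boundaryExtension_eq_of_eqOn_smul_trans`, **proved** here);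
3. the SLE_κ trace is scale invariant in law, `(t ↦ c γ(t / c²)) ~ γ`
   (SLE scaling, Lawler (2005), Prop. 6.5; Rohde–Schramm (2005), Prop. 2.1 (i)); vendored here
   as the named fact `Literature.Probability.RandomPlanarGeometry.identDistrib_sleTrace_scale`;
4. `r γ` and `t ↦ r γ(t / r²)` differ by the time change `t ↦ r² t`, which after the time
   compactification `s ↦ s / (1 - s)` of `Literature.Probability.RandomPlanarGeometry.IsCompactifiedImage` is the Möbius reparametrisation
   `Literature.rayScale (r²)` of `[0, 1]`; curve classes are invariant under reparametrisation
   (`Literature.Probability.RandomPlanarGeometry.IsCompactifiedImage.comp_mul` / `of_comp_mul` with `CurveClass.mk_reparam`, packaged as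
   `Literature.Probability.RandomPlanarGeometry.IsCompactifiedImage.mk_eq_of_comp_mul`; **proved**);
5. to transport the identity in law (3) along the deterministic functional
   "trace ↦ class of its compactified `Φ`-image" one needs a version of this functional that is
   **measurable** for the product σ-algebra on `ℝ≥0 → ℂ`: `Literature.compactifiedClass Φ b`, defined
   through Bernstein approximants of the compactified curve sampled at the rational nodes `k / n`
   and `Filter.limUnder` in `C([0,1], ℂ)`; it is measurable for measurable `Φ`
   (`Literature.Probability.RandomPlanarGeometry.measurable_compactifiedClass`, **proved**, via
   `MeasureTheory.StronglyMeasurable.limUnder` and `bernsteinApproximation_uniform`) and computes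
   the right class (`Literature.Probability.RandomPlanarGeometry.IsCompactifiedImage.compactifiedClass_eq`, **proved**);
6. measurability of `Φ = φ.boundaryExtension` on the closed half-plane is taken from
   Carathéodory's theorem (`Literature.Probability.RandomPlanarGeometry.JordanDomain.continuousOn_boundaryExtension`, named fact).

The assembly `Literature.Probability.RandomPlanarGeometry.IsSLECurve.map_eq_of_facts` proves `IsSLECurve.map_eq` from the three named
facts (1), (3), (6); everything else is proved. Since (1) and (6) are theorems relative to the
printed disc form of Carathéodory's theorem (`Literature.Probability.RandomPlanarGeometry.JordanDomain.exists_continuousOn_extension`,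
Pommerenke (1992), Thm 2.6) — `Literature.Probability.RandomPlanarGeometry.MarkedDomain.IsChordalUniformizing.exists_eq_trans_smul_of_disc`
(`Literature.Probability.RandomPlanarGeometry.HalfPlaneAutomorphism`: Schwarz's lemma, the
automorphisms of `ℍₒ`, boundary behaviour of `φ⁻¹`) and
`Literature.Probability.RandomPlanarGeometry.JordanDomain.continuousOn_boundaryExtension_of_disc`
(`Literature.Probability.RandomPlanarGeometry.CaratheodoryHalfPlane`) — the final reduction
`Literature.Probability.RandomPlanarGeometry.IsSLECurve.map_eq_of_disc` has exactly two literature inputs: Carathéodory's theorem and the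
SLE scaling law (3); and since Carathéodory's theorem is in turn proved from the Jordan curve
theorem (`Literature.Probability.RandomPlanarGeometry.CaratheodoryExtension`),
`Literature.Probability.RandomPlanarGeometry.IsSLECurve.map_eq_of_jordanCurveTheorem` reduces `map_eq` to the Jordan curve theorem
(`Literature.Topology.PlaneTopology.JordanCurveTheorem`) and (3); and since the Jordan curve theorem is now proved
(`Literature.Topology.PlaneTopology.JordanCurveTheorem_holds`, `Literature.Topology.PlaneTopology.JordanCurveProofs`, by
Eilenberg's continuous-logarithm method), `Literature.Probability.RandomPlanarGeometry.IsSLECurve.map_eq_of_sleScaling` reduces `map_eq`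
to the single printed input (3), the SLE scaling law. The inputs of (3) itself are Loewner scaling
`Loewner.hull_scale` (proved), uniqueness of the generating curve
`Loewner.IsGeneratedByCurve.unique`, Brownian scaling (proved) and measurability of the trace as
a function of the driver.

## References

* G. F. Lawler, *Conformally Invariant Processes in the Plane*, AMS Math. Surveys 114 (2005),
  §6.1: Prop. 6.5 (SLE scaling) and the definition of chordal SLE_κ in a domain `D`
  ("the definition is independent of the choice of map up to a time change").
* S. Rohde, O. Schramm, *Basic properties of SLE*, Ann. of Math. 161 (2005), Prop. 2.1 (i).
* Ch. Pommerenke, *Boundary Behaviour of Conformal Maps* (1992), Thm 2.6 (Carathéodory).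
-/

noncomputable section

open Set Filter Topology MeasureTheory ProbabilityTheory
open UpperHalfPlane (upperHalfPlaneSet isOpen_upperHalfPlaneSet)
open scoped NNReal unitInterval

namespace Literature.Probability.RandomPlanarGeometry

/-! ### Möbius time changes of `[0, 1]` compatible with `rayParam` -/

section RayScale

variable {a b : ℝ}

/-- The denominator `1 + (a - 1) s = (1 - s) + a s` of `rayScale a` is positive on `[0, 1]` for
`a > 0`. [folklore] -/
theorem rayScale_den_pos (ha : 0 < a) (s : I) : 0 < 1 + (a - 1) * (s : ℝ) := by
  rcases lt_or_ge (s : ℝ) 1 with h | h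
  · nlinarith [mul_nonneg ha.le s.2.1]
  · nlinarith [mul_pos ha (zero_lt_one.trans_le h), s.2.2]

/-- The Möbius self-map `s ↦ a s / (1 + (a - 1) s)` of `[0, 1]` (`a > 0`), as a function; it is
the conjugate of the dilation `t ↦ a t` of `[0, ∞)` by `rayParam : s ↦ s / (1 - s)`
(`rayParam_rayScale`). [folklore] -/
def rayScaleFun (a : ℝ) (ha : 0 < a) (s : I) : I :=
  ⟨a * s / (1 + (a - 1) * s), div_nonneg (mul_nonneg ha.le s.2.1) (rayScale_den_pos ha s).le,
    (div_le_one (rayScale_den_pos ha s)).2 (by nlinarith [s.2.2])⟩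

/-- Value of `rayScaleFun`. [folklore] -/
@[simp] theorem coe_rayScaleFun (ha : 0 < a) (s : I) :
    (rayScaleFun a ha s : ℝ) = a * s / (1 + (a - 1) * s) := rfl

/-- `rayScaleFun b` inverts `rayScaleFun a` when `a b = 1`. [folklore] -/
theorem rayScaleFun_rayScaleFun (ha : 0 < a) (hb : 0 < b) (hab : a * b = 1) (s : I) :
    rayScaleFun b hb (rayScaleFun a ha s) = s := by
  obtain rfl : b = a⁻¹ := (eq_inv_of_mul_eq_one_right hab)
  ext
  have ha0 : a ≠ 0 := ha.ne'
  have hD : 1 + (a - 1) * (s : ℝ) ≠ 0 := (rayScale_den_pos ha s).ne'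
  simp only [coe_rayScaleFun]
  have e1 : a⁻¹ * (a * (s : ℝ) / (1 + (a - 1) * s)) = s / (1 + (a - 1) * s) := by
    rw [← mul_div_assoc, inv_mul_cancel_left₀ ha0]
  have e2 : 1 + (a⁻¹ - 1) * (a * (s : ℝ) / (1 + (a - 1) * s)) = 1 / (1 + (a - 1) * s) := by
    rw [eq_div_iff hD, add_mul, one_mul, mul_assoc, div_mul_cancel₀ _ hD]
    linear_combination (↑s : ℝ) * inv_mul_cancel₀ ha0
  rw [e1, e2, div_div_div_cancel_right₀ hD, div_one]

/-- `rayScaleFun a` is an order embedding. [folklore] -/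
theorem rayScaleFun_le_iff (ha : 0 < a) (s t : I) :
    rayScaleFun a ha s ≤ rayScaleFun a ha t ↔ s ≤ t := by
  change (a * s / (1 + (a - 1) * s) : ℝ) ≤ a * t / (1 + (a - 1) * t) ↔ (s : ℝ) ≤ t
  rw [div_le_div_iff₀ (rayScale_den_pos ha s) (rayScale_den_pos ha t)]
  constructor
  · intro h
    nlinarith
  · intro h
    nlinarith [mul_nonneg ha.le (sub_nonneg.2 h)]

/-- The **Möbius time change** `rayScale a : [0, 1] ≃o [0, 1]`, `s ↦ a s / (1 + (a - 1) s)`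
(`a > 0`), an increasing self-homeomorphism of the parameter interval fixing `0` and `1`; under
the compactification `rayParam : s ↦ s / (1 - s)` it is the dilation `t ↦ a t` of `[0, ∞)`
(`rayParam_rayScale`). Used to identify the compactified images of a half-infinite curve and of
its time-rescaling as the same curve class. Lawler (2005), §6.1 (chordal SLE in a domain is
defined modulo time change). [folklore] -/
def rayScale (a : ℝ) (ha : 0 < a) : I ≃o I where
  toFun := rayScaleFun a ha
  invFun := rayScaleFun a⁻¹ (inv_pos.2 ha)
  left_inv s := rayScaleFun_rayScaleFun ha (inv_pos.2 ha) (mul_inv_cancel₀ ha.ne') s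
  right_inv s := rayScaleFun_rayScaleFun (inv_pos.2 ha) ha (inv_mul_cancel₀ ha.ne') s
  map_rel_iff' := rayScaleFun_le_iff ha _ _

/-- Value of `rayScale`. [folklore] -/
@[simp] theorem coe_rayScale (ha : 0 < a) (s : I) :
    (rayScale a ha s : ℝ) = a * s / (1 + (a - 1) * s) := rfl

/-- `rayScale a` fixes `1`. [folklore] -/
@[simp] theorem rayScale_one (ha : 0 < a) : rayScale a ha 1 = 1 := by
  ext
  simp only [coe_rayScale, Set.Icc.coe_one, mul_one, add_sub_cancel]
  exact div_self ha.ne'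

/-- `rayScale a s < 1 ↔ s < 1`. [folklore] -/
theorem rayScale_lt_one_iff (ha : 0 < a) {s : I} : (rayScale a ha s : ℝ) < 1 ↔ (s : ℝ) < 1 := by
  rw [coe_rayScale, div_lt_one (rayScale_den_pos ha s)]
  constructor <;> intro h <;> nlinarith

/-- **`rayScale` is the dilation `t ↦ a t` in the coordinate `t = rayParam s = s / (1 - s)`.**
(At `s = 1` both sides are the junk value `0`.) [folklore] -/
theorem rayParam_rayScale (ha : 0 < a) (s : I) :
    (rayParam (rayScale a ha s) : ℝ) = a * rayParam s := by
  simp only [coe_rayParam, coe_rayScale]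
  rcases eq_or_lt_of_le s.2.2 with h1 | h1
  · rw [h1]
    simp [div_self ha.ne']
  · have hD := rayScale_den_pos ha s
    have e1 : 1 - a * (s : ℝ) / (1 + (a - 1) * s) = (1 - s) / (1 + (a - 1) * s) := by
      rw [eq_div_iff hD.ne', sub_mul, div_mul_cancel₀ _ hD.ne']
      ring
    rw [e1, div_div_div_cancel_right₀ hD.ne', mul_div_assoc]

end RayScale

/-! ### Compactified images: uniqueness, change of `Φ` on the range, time scaling -/

namespace IsCompactifiedImage

variable {Φ Φ' : ℂ → ℂ} {γ : ℝ≥0 → ℂ} {b : ℂ} {c c' : Curve ℂ}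

/-- The compactified image is unique: `IsCompactifiedImage Φ γ b` determines the curve. [folklore] -/
theorem unique (h : IsCompactifiedImage Φ γ b c) (h' : IsCompactifiedImage Φ γ b c') : c = c' := by
  refine DFunLike.ext c c' fun s ↦ ?_
  rcases eq_or_lt_of_le s.2.2 with hs | hs
  · obtain rfl : s = 1 := Subtype.ext hs
    rw [h.2, h'.2]
  · rw [h.1 s hs, h'.1 s hs]

/-- Only the values of `Φ` on the range of `γ` matter. [folklore] -/
theorem congr_left (h : IsCompactifiedImage Φ γ b c) (hΦ : ∀ t, Φ' (γ t) = Φ (γ t)) :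
    IsCompactifiedImage Φ' γ b c :=
  ⟨fun s hs ↦ (h.1 s hs).trans (hΦ _).symm, h.2⟩

/-- **Time scaling.** If `c` is the compactified image of `γ`, then the compactified image of the
time-rescaled curve `t ↦ γ (a t)` (`a > 0`) is the reparametrisation `c ∘ rayScale a` of `c`.
Lawler (2005), §6.1 (independence of the uniformizing map up to time change). [folklore] -/
theorem comp_mul (h : IsCompactifiedImage Φ γ b c) {a : ℝ≥0} (ha : a ≠ 0) :
    IsCompactifiedImage Φ (fun t ↦ γ (a * t)) b
      (c.reparam (rayScale (a : ℝ) (NNReal.coe_pos.2 (pos_iff_ne_zero.2 ha)))) := by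
  have ha' : 0 < (a : ℝ) := NNReal.coe_pos.2 (pos_iff_ne_zero.2 ha)
  refine ⟨fun s hs ↦ ?_, ?_⟩
  · rw [Curve.reparam_apply, h.1 _ ((rayScale_lt_one_iff ha').2 hs)]
    congr 2
    ext
    push_cast
    rw [rayParam_rayScale]
  · rw [Curve.reparam_apply, rayScale_one, h.2]

/-- Converse time scaling: the compactified image of `γ` from that of `t ↦ γ (a t)`. [folklore] -/
theorem of_comp_mul {a : ℝ≥0} (ha : a ≠ 0) (h : IsCompactifiedImage Φ (fun t ↦ γ (a * t)) b c) :
    IsCompactifiedImage Φ γ b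
      (c.reparam (rayScale ((a⁻¹ : ℝ≥0) : ℝ)
        (NNReal.coe_pos.2 (pos_iff_ne_zero.2 (inv_ne_zero ha))))) := by
  have := h.comp_mul (inv_ne_zero ha)
  simpa only [← mul_assoc, mul_inv_cancel₀ ha, one_mul] using this

/-- **Curve classes of compactified images are invariant under time scaling of the half-infinite
curve**: if `c` is the compactified image of `γ` and `c'` that of `t ↦ γ (a t)` (`a > 0`), then
`c'` is a reparametrisation of `c` and the two define the same point of `CurveClass ℂ`.
Lawler (2005), §6.1. [folklore] -/
theorem mk_eq_of_comp_mul {a : ℝ≥0} (ha : a ≠ 0) (h : IsCompactifiedImage Φ γ b c)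
    (h' : IsCompactifiedImage Φ (fun t ↦ γ (a * t)) b c') :
    CurveClass.mk c' = CurveClass.mk c := by
  rw [← (h.comp_mul ha).unique h', CurveClass.mk_reparam]

end IsCompactifiedImage

/-! ### Boundary extensions and dilations of `ℍₒ` -/

namespace ConformalEquiv

variable {V : Set ℂ}

/-- **Boundary extensions commute with dilations.** If `φ' = φ ∘ (r • ·)` on `ℍₒ` (`r > 0`), then
`φ'.boundaryExtension x = φ.boundaryExtension (r • x)` for *every* `x : ℂ` — including the points
where no boundary value exists and both sides are the (same) junk value of `extendFrom`, because
the dilation is a homeomorphism of `ℂ` preserving `ℍₒ`, so that the two defining filters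
`map φ' (𝓝[ℍₒ] x)` and `map φ (𝓝[ℍₒ] (r • x))` coincide. Pommerenke (1992), §2.1. [folklore] -/
theorem boundaryExtension_eq_of_eqOn_smul_trans (φ φ' : ConformalEquiv upperHalfPlaneSet V)
    {r : ℝ} (hr : 0 < r) (h : EqOn φ' ((smulUpperHalfPlane r hr).trans φ) upperHalfPlaneSet)
    (x : ℂ) : φ'.boundaryExtension x = φ.boundaryExtension (r • x) := by
  have himage : (fun z : ℂ ↦ r • z) '' upperHalfPlaneSet = upperHalfPlaneSet :=
    (smulUpperHalfPlane r hr).bijOn.image_eq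
  have hind : IsInducing (fun z : ℂ ↦ r • z) := (Homeomorph.smulOfNeZero r hr.ne').isInducing
  have h1 : map φ' (𝓝[upperHalfPlaneSet] x) = map φ (𝓝[upperHalfPlaneSet] (r • x)) := by
    rw [Filter.map_congr h.eventuallyEq_nhdsWithin]
    change map (φ ∘ fun z : ℂ ↦ r • z) _ = _
    rw [← Filter.map_map, hind.map_nhdsWithin_eq, himage]
  unfold boundaryExtension extendFrom limUnder
  rw [h1]

/-- The boundary extension of `φ : ℍₒ → V` **truncated to the closed upper half-plane**: equal to
`φ.boundaryExtension` on `closure ℍₒ = {0 ≤ im}` and to `0` below the real axis. Only its values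
on `closure ℍₒ` are ever used (SLE traces live there); the truncation makes it Borel measurable as
soon as the boundary extension is continuous on `closure ℍₒ` (Carathéodory).
Pommerenke (1992), §2.1. [folklore] -/
def truncatedBoundaryExtension (φ : ConformalEquiv upperHalfPlaneSet V) : ℂ → ℂ :=
  {z : ℂ | 0 ≤ z.im}.piecewise φ.boundaryExtension 0

/-- `closure ℍₒ = {z | 0 ≤ im z}` (Mathlib `Complex.closure_setOf_lt_im`). [folklore] -/
theorem closure_upperHalfPlaneSet_eq : closure upperHalfPlaneSet = {z : ℂ | 0 ≤ z.im} :=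
  Complex.closure_setOf_lt_im 0

/-- On the closed upper half-plane the truncated boundary extension is the boundary extension. [folklore] -/
theorem truncatedBoundaryExtension_eq (φ : ConformalEquiv upperHalfPlaneSet V) {z : ℂ}
    (hz : 0 ≤ z.im) : φ.truncatedBoundaryExtension z = φ.boundaryExtension z :=
  Set.piecewise_eq_of_mem _ _ _ hz

/-- Given Carathéodory's theorem in the form `JordanDomain.continuousOn_boundaryExtension`
(hypothesis `h₇`), the truncated boundary extension of `φ : ℍₒ → D` onto a Jordan domain is Borel
measurable. Pommerenke (1992), Thm 2.6. [folklore] -/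
theorem measurable_truncatedBoundaryExtension (h₇ : JordanDomain.continuousOn_boundaryExtension)
    (D : JordanDomain) (φ : ConformalEquiv upperHalfPlaneSet D.carrier) :
    Measurable φ.truncatedBoundaryExtension := by
  have hc : ContinuousOn φ.boundaryExtension {z : ℂ | 0 ≤ z.im} :=
    closure_upperHalfPlaneSet_eq ▸ h₇ D φ
  unfold truncatedBoundaryExtension
  exact hc.measurable_piecewise continuousOn_const
    (isClosed_le continuous_const Complex.continuous_im).measurableSet

end ConformalEquiv

/-! ### A measurable version of "class of the compactified image" -/

section Compactification

variable {Φ : ℂ → ℂ} {γ : ℝ≥0 → ℂ} {b : ℂ} {c : Curve ℂ}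

/-- The Bernstein polynomial `bernstein n k` as a complex-valued continuous function on `[0, 1]`. [folklore] -/
def bernsteinC (n k : ℕ) : C(I, ℂ) :=
  ⟨fun s ↦ ((bernstein n k s : ℝ) : ℂ), Complex.continuous_ofReal.comp (bernstein n k).continuous⟩

/-- Value of `bernsteinC`. [folklore] -/
@[simp] theorem bernsteinC_apply (n k : ℕ) (s : I) : bernsteinC n k s = ((bernstein n k s : ℝ) : ℂ) :=
  rfl

/-- The value at parameter `s ∈ [0, 1]` of the would-be compactified image of `γ` under `Φ` with
endpoint `b`: `Φ (γ (s / (1 - s)))` for `s < 1` and `b` at `s = 1` (cf. `IsCompactifiedImage`). [folklore] -/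
def nodeValue (Φ : ℂ → ℂ) (b : ℂ) (w : ℝ≥0 → ℂ) (s : I) : ℂ :=
  if (s : ℝ) < 1 then Φ (w (rayParam s)) else b

/-- The `n`-th **Bernstein approximant** of the compactified image of `w` under `Φ` (endpoint `b`):
`∑ₖ nodeValue (k/n) · bernstein n k`, an element of `C([0,1], ℂ)` depending on `w` only through
the finitely many values `w (rayParam (k / n))`. [folklore] -/
def compactifiedApprox (Φ : ℂ → ℂ) (b : ℂ) (w : ℝ≥0 → ℂ) (n : ℕ) : C(I, ℂ) :=
  ∑ k : Fin (n + 1), nodeValue Φ b w (bernstein.z k) • bernsteinC n k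

/-- The **compactified image as an element of `C([0,1], ℂ)`**: the limit in sup norm of the
Bernstein approximants `compactifiedApprox Φ b w n` (junk value `Classical.choice` when they do not
converge). When `w` has a compactified image `c` (`IsCompactifiedImage Φ w b c`) this is `c`
(`IsCompactifiedImage.compactifiedLimit_eq`, Bernstein's theorem). [folklore] -/
def compactifiedLimit (Φ : ℂ → ℂ) (b : ℂ) (w : ℝ≥0 → ℂ) : C(I, ℂ) :=
  limUnder atTop (compactifiedApprox Φ b w)

/-- The **class of the compactified image** of `w : ℝ≥0 → ℂ` under `Φ` with endpoint `b`, as a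
point of `CurveClass ℂ`; a version of `w ↦ CurveClass.mk c` (`IsCompactifiedImage Φ w b c`) that
is defined for every `w` and measurable for the product σ-algebra (`measurable_compactifiedClass`). [folklore] -/
def compactifiedClass (Φ : ℂ → ℂ) (b : ℂ) (w : ℝ≥0 → ℂ) : CurveClass ℂ :=
  CurveClass.mk ⟨compactifiedLimit Φ b w⟩

/-- Under `IsCompactifiedImage Φ γ b c` the node values are the values of `c`. [folklore] -/
theorem IsCompactifiedImage.nodeValue_eq (h : IsCompactifiedImage Φ γ b c) (s : I) :
    nodeValue Φ b γ s = c s := by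
  unfold nodeValue
  split_ifs with hs
  · exact (h.1 s hs).symm
  · obtain rfl : s = 1 := Subtype.ext (le_antisymm s.2.2 (not_lt.1 hs))
    exact h.2.symm

/-- Under `IsCompactifiedImage Φ γ b c` the approximants are the Bernstein approximations of `c`. [folklore] -/
theorem IsCompactifiedImage.compactifiedApprox_eq (h : IsCompactifiedImage Φ γ b c) (n : ℕ) :
    compactifiedApprox Φ b γ n = bernsteinApproximation n c.toContinuousMap := by
  ext s : 1
  simp [compactifiedApprox, bernsteinApproximation.apply, h.nodeValue_eq, ContinuousMap.coe_sum,
    Finset.sum_apply, mul_comm]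

/-- Under `IsCompactifiedImage Φ γ b c` the approximants converge uniformly to `c`
(Bernstein, Mathlib `bernsteinApproximation_uniform`). [folklore] -/
theorem IsCompactifiedImage.tendsto_compactifiedApprox (h : IsCompactifiedImage Φ γ b c) :
    Tendsto (compactifiedApprox Φ b γ) atTop (𝓝 c.toContinuousMap) := by
  have : compactifiedApprox Φ b γ = fun n ↦ bernsteinApproximation n c.toContinuousMap :=
    funext h.compactifiedApprox_eq
  rw [this]
  exact bernsteinApproximation_uniform _

/-- Under `IsCompactifiedImage Φ γ b c`, `compactifiedLimit Φ b γ = c`. [folklore] -/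
theorem IsCompactifiedImage.compactifiedLimit_eq (h : IsCompactifiedImage Φ γ b c) :
    compactifiedLimit Φ b γ = c.toContinuousMap :=
  h.tendsto_compactifiedApprox.limUnder_eq

/-- **`compactifiedClass` computes the class of the compactified image**: under
`IsCompactifiedImage Φ γ b c`, `compactifiedClass Φ b γ = CurveClass.mk c`. [folklore] -/
theorem IsCompactifiedImage.compactifiedClass_eq (h : IsCompactifiedImage Φ γ b c) :
    compactifiedClass Φ b γ = CurveClass.mk c := by
  rw [compactifiedClass, h.compactifiedLimit_eq]

/-- `f ↦ ⟨f⟩ : C([0,1], ℂ) → Curve ℂ` is continuous (1-Lipschitz: the reparametrisation distance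
is at most the sup distance). [folklore] -/
theorem continuous_curveMk : Continuous fun f : C(I, ℂ) ↦ (⟨f⟩ : Curve ℂ) :=
  (LipschitzWith.mk_one fun f g ↦ Curve.dist_le_dist_toContinuousMap ⟨f⟩ ⟨g⟩).continuous

/-- Node values are measurable in `w` (product σ-algebra) for measurable `Φ`. [folklore] -/
theorem measurable_nodeValue (hΦ : Measurable Φ) (b : ℂ) (s : I) :
    Measurable fun w : ℝ≥0 → ℂ ↦ nodeValue Φ b w s := by
  unfold nodeValue
  split_ifs
  · exact hΦ.comp (measurable_pi_apply _)
  · exact measurable_const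

/-- The Bernstein approximants are strongly measurable in `w`: a continuous map of finitely many
measurable node values. [folklore] -/
theorem stronglyMeasurable_compactifiedApprox (hΦ : Measurable Φ) (b : ℂ) (n : ℕ) :
    StronglyMeasurable fun w : ℝ≥0 → ℂ ↦ compactifiedApprox Φ b w n := by
  have hc : Continuous fun d : Fin (n + 1) → ℂ ↦ ∑ k : Fin (n + 1), d k • bernsteinC n k :=
    continuous_finsetSum _ fun k _ ↦ (continuous_apply k).smul continuous_const
  have hm : Measurable fun (w : ℝ≥0 → ℂ) (k : Fin (n + 1)) ↦ nodeValue Φ b w (bernstein.z k) :=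
    measurable_pi_lambda _ fun k ↦ measurable_nodeValue hΦ b _
  exact hc.stronglyMeasurable.comp_measurable hm

/-- The compactified limit curve is strongly measurable in `w`
(Mathlib `MeasureTheory.StronglyMeasurable.limUnder`: limits of strongly measurable sequences in
a completely metrizable space, with a constant junk value off the convergence set). [folklore] -/
theorem stronglyMeasurable_compactifiedLimit (hΦ : Measurable Φ) (b : ℂ) :
    StronglyMeasurable (compactifiedLimit Φ b) :=
  MeasureTheory.StronglyMeasurable.limUnder (l := atTop)
    (f := fun n (w : ℝ≥0 → ℂ) ↦ compactifiedApprox Φ b w n)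
    (stronglyMeasurable_compactifiedApprox hΦ b)

/-- **Measurability of the compactification functional**: for Borel measurable `Φ`,
`compactifiedClass Φ b : (ℝ≥0 → ℂ) → CurveClass ℂ` is measurable from the product σ-algebra to
the Borel σ-algebra of the curve-class metric. [folklore] -/
theorem measurable_compactifiedClass (hΦ : Measurable Φ) (b : ℂ) :
    Measurable (compactifiedClass Φ b) :=
  ((CurveClass.continuous_mk.comp continuous_curveMk).comp_stronglyMeasurable
    (stronglyMeasurable_compactifiedLimit hΦ b)).measurable

end Compactification

/-! ### Scale invariance of the SLE trace (named fact) and the assembly -/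

/-- **SLE scaling** (scale invariance in law of the chordal SLE_κ trace): for `c > 0` the random
curves `t ↦ γ(t)` and `t ↦ c γ(t / c²)` (`γ = sleTrace κ ω` the SLE_κ trace on the canonical
space) have the same law, as random elements of `ℝ≥0 → ℂ` with the product σ-algebra (in
particular both are a.e.-measurable). Printed for `κ > 0` with `r = c⁻¹`: "if `γ` is an SLE_κ
path and `γ̂(t) := r⁻¹ γ(r² t)`, then `γ̂` has the distribution of an SLE_κ path", Lawler (2005),
Prop. 6.5; hull form `t ↦ α^{-1/2} K_{αt} ~ K_t` for every `κ ≥ 0` in Rohde–Schramm (2005), §2.1,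
Prop. 2.1 (i) (take `c = α^{-1/2}`), which covers the statement below for every `κ : ℝ≥0`. The
printed proof combines Brownian scaling (`identDistrib_sleDriving_scale`), scaling of Loewner
chains (`Loewner.hull_scale`) and uniqueness of the generating curve
(`Loewner.IsGeneratedByCurve.unique`).
[cite: Lawler2005, Prop. 6.5] [cite: RohdeSchramm2005, Prop. 2.1(i)] -/
def identDistrib_sleTrace_scale : Prop :=
  ∀ (κ : ℝ≥0) {c : ℝ≥0}, c ≠ 0 →
    IdentDistrib (fun ω ↦ sleTrace κ ω) (fun ω t ↦ (c : ℂ) * sleTrace κ ω (t / c ^ 2))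
      Process.preWienerMeasure Process.preWienerMeasure

/-- **Independence of the uniformizing map, reduced to named facts.** `IsSLECurve.map_eq` (two
chordal SLE_κ random curves in the same Dobrushin domain have the same law on `CurveClass ℂ`)
follows from: uniqueness of chordal uniformizing maps up to dilation (`h₁`, Lawler (2005), §6.1),
SLE scaling (`h₅`, Lawler (2005), Prop. 6.5) and Carathéodory continuity of the boundary
extension (`h₇`, Pommerenke (1992), Thm 2.6). Proof: with `φ' = φ ∘ (r • ·)` on `ℍₒ`, a.s.
`Γ = Ψ (γ)` and `Γ' = Ψ (t ↦ r γ(t / r²))` for the *measurable* functional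
`Ψ = compactifiedClass Φ b` (`Φ` the truncated boundary extension of `φ`, `b = D.pt 1`), using
`boundaryExtension_eq_of_eqOn_smul_trans` and reparametrisation invariance
(`IsCompactifiedImage.of_comp_mul`); then push the identity in law `h₅` through `Ψ`.
Lawler (2005), §6.1 (paragraph after Remark 6.7). [cite: Lawler2005, §6.1] -/
theorem IsSLECurve.map_eq_of_facts (h₁ : MarkedDomain.IsChordalUniformizing.exists_eq_trans_smul)
    (h₅ : identDistrib_sleTrace_scale) (h₇ : JordanDomain.continuousOn_boundaryExtension) :
    IsSLECurve.map_eq := by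
  intro κ D Γ Γ' hΓ hΓ'
  obtain ⟨-, φ, hφ, hae⟩ := hΓ
  obtain ⟨-, φ', hφ', hae'⟩ := hΓ'
  obtain ⟨r, hr, hEq⟩ := h₁ hφ hφ'
  have hΦm : Measurable φ.truncatedBoundaryExtension :=
    ConformalEquiv.measurable_truncatedBoundaryExtension h₇ D.toJordanDomain φ
  have hΨ : Measurable (compactifiedClass φ.truncatedBoundaryExtension (D.pt 1)) :=
    measurable_compactifiedClass hΦm _
  -- the dilation factor as an element of `ℝ≥0`
  obtain ⟨rn, hrn0, hrn⟩ : ∃ rn : ℝ≥0, rn ≠ 0 ∧ (rn : ℝ) = r :=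
    ⟨r.toNNReal, (Real.toNNReal_pos.2 hr).ne', Real.coe_toNNReal r hr.le⟩
  have hID := h₅ κ hrn0
  -- a.s. `Γ = Ψ ∘ trace`
  have hΓ₁ : Γ =ᵐ[Process.preWienerMeasure]
      compactifiedClass φ.truncatedBoundaryExtension (D.pt 1) ∘ fun ω ↦ sleTrace κ ω := by
    filter_upwards [hae] with ω ⟨hgen, c, hΓc, hc⟩
    rw [Function.comp_apply, hΓc]
    exact (IsCompactifiedImage.compactifiedClass_eq (hc.congr_left fun t ↦
      φ.truncatedBoundaryExtension_eq (hgen.im_nonneg t))).symm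
  -- a.s. `Γ' = Ψ ∘ (rescaled trace)`
  have hΓ₂ : Γ' =ᵐ[Process.preWienerMeasure]
      compactifiedClass φ.truncatedBoundaryExtension (D.pt 1) ∘
        fun ω t ↦ (rn : ℂ) * sleTrace κ ω (t / rn ^ 2) := by
    filter_upwards [hae'] with ω ⟨hgen, c, hΓc, hc⟩
    rw [Function.comp_apply, hΓc]
    -- `c` is the compactified `Φ`-image of the dilated trace `r γ`
    have hc' : IsCompactifiedImage φ.truncatedBoundaryExtension
        (fun t ↦ (rn : ℂ) * sleTrace κ ω (rn ^ 2 * t / rn ^ 2)) (D.pt 1) c := by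
      refine ⟨fun s hs ↦ ?_, hc.2⟩
      have him : 0 ≤ ((rn : ℂ) * sleTrace κ ω (rayParam s)).im := by
        rw [Complex.im_ofReal_mul]
        exact mul_nonneg rn.2 (hgen.im_nonneg _)
      rw [hc.1 s hs, φ.boundaryExtension_eq_of_eqOn_smul_trans φ' hr hEq]
      beta_reduce
      rw [mul_div_cancel_left₀ _ (pow_ne_zero 2 hrn0), φ.truncatedBoundaryExtension_eq him,
        Complex.real_smul, ← hrn]
    have key := IsCompactifiedImage.of_comp_mul
      (γ := fun t ↦ (rn : ℂ) * sleTrace κ ω (t / rn ^ 2)) (pow_ne_zero 2 hrn0) hc'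
    rw [key.compactifiedClass_eq, CurveClass.mk_reparam]
  -- push the identity in law through the measurable functional
  calc Process.preWienerMeasure.map Γ
      = Process.preWienerMeasure.map
          (compactifiedClass φ.truncatedBoundaryExtension (D.pt 1) ∘ fun ω ↦ sleTrace κ ω) :=
        Measure.map_congr hΓ₁
    _ = (Process.preWienerMeasure.map fun ω ↦ sleTrace κ ω).map
          (compactifiedClass φ.truncatedBoundaryExtension (D.pt 1)) :=
        (AEMeasurable.map_map_of_aemeasurable hΨ.aemeasurable hID.aemeasurable_fst).symm
    _ = (Process.preWienerMeasure.map fun ω t ↦ (rn : ℂ) * sleTrace κ ω (t / rn ^ 2)).map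
          (compactifiedClass φ.truncatedBoundaryExtension (D.pt 1)) := by
        rw [hID.map_eq]
    _ = Process.preWienerMeasure.map
          (compactifiedClass φ.truncatedBoundaryExtension (D.pt 1) ∘
            fun ω t ↦ (rn : ℂ) * sleTrace κ ω (t / rn ^ 2)) :=
        AEMeasurable.map_map_of_aemeasurable hΨ.aemeasurable hID.aemeasurable_snd
    _ = Process.preWienerMeasure.map Γ' := (Measure.map_congr hΓ₂).symm

/-- **Independence of the uniformizing map, reduced to Carathéodory's theorem and SLE scaling.**
`IsSLECurve.map_eq` follows from the printed disc form of Carathéodory's theorem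
(`JordanDomain.exists_continuousOn_extension`, Pommerenke (1992), Thm. 2.6) and the scale
invariance in law of the SLE trace (`identDistrib_sleTrace_scale`, Lawler (2005), Prop. 6.5;
Rohde–Schramm (2005), Prop. 2.1 (i)): the two other inputs of `IsSLECurve.map_eq_of_facts` are
now theorems relative to Carathéodory — uniqueness of chordal uniformizing maps up to dilation
(`MarkedDomain.IsChordalUniformizing.exists_eq_trans_smul_of_disc`, via Schwarz's lemma and the
automorphisms of `ℍₒ`) and continuity of the boundary extension
(`JordanDomain.continuousOn_boundaryExtension_of_disc`). Lawler (2005), §6.1 (paragraph after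
Remark 6.7). [cite: Lawler2005, §6.1] -/
theorem IsSLECurve.map_eq_of_disc (hC : JordanDomain.exists_continuousOn_extension)
    (h₅ : identDistrib_sleTrace_scale) : IsSLECurve.map_eq :=
  IsSLECurve.map_eq_of_facts (MarkedDomain.IsChordalUniformizing.exists_eq_trans_smul_of_disc hC)
    h₅ (JordanDomain.continuousOn_boundaryExtension_of_disc hC)

/-- **Independence of the uniformizing map, reduced to the Jordan curve theorem and SLE
scaling.** Since Carathéodory's theorem is proved from the Jordan curve theorem in
`Literature.Probability.RandomPlanarGeometry.CaratheodoryExtension`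
(`JordanDomain.exists_continuousOn_extension_of_jordanCurveTheorem`), `IsSLECurve.map_eq` follows
from the Jordan curve theorem (`Literature.Topology.PlaneTopology.JordanCurveTheorem`, McCleary (2006), Ch. 9) and the scale
invariance in law of the SLE trace (`identDistrib_sleTrace_scale`, Lawler (2005), Prop. 6.5;
Rohde–Schramm (2005), Prop. 2.1 (i)). Lawler (2005), §6.1. [cite: Lawler2005, §6.1] -/
theorem IsSLECurve.map_eq_of_jordanCurveTheorem (hJ : Literature.Topology.PlaneTopology.JordanCurveTheorem)
    (h₅ : identDistrib_sleTrace_scale) : IsSLECurve.map_eq :=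
  IsSLECurve.map_eq_of_disc (JordanDomain.exists_continuousOn_extension_of_jordanCurveTheorem hJ) h₅

/-- **Independence of the uniformizing map, reduced to SLE scaling alone.** With the Jordan curve
theorem proved (`Literature.Topology.PlaneTopology.JordanCurveTheorem_holds`), hence Carathéodory's theorem
(`JordanDomain.exists_continuousOn_extension_of_jordanCurveTheorem`), uniqueness of chordal
uniformizing maps up to dilation and continuity of the boundary extension all theorems, the named
fact `IsSLECurve.map_eq` follows from the one remaining printed input: the scale invariance in law
of the SLE_κ trace (`identDistrib_sleTrace_scale`, Lawler (2005), Prop. 6.5; Rohde–Schramm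
(2005), Prop. 2.1 (i)). Lawler (2005), §6.1. [cite: Lawler2005, §6.1] -/
theorem IsSLECurve.map_eq_of_sleScaling (h₅ : identDistrib_sleTrace_scale) : IsSLECurve.map_eq :=
  IsSLECurve.map_eq_of_jordanCurveTheorem Literature.Topology.PlaneTopology.JordanCurveTheorem_holds h₅

end Literature.Probability.RandomPlanarGeometry
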